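import Mathlib
import Literature.Computability.AlgebraicComplexity.StandardFamiliesProofs
import Literature.NumberTheory.DiophantineGeometry.PowerTraceStabilizer
import Summits.ValiantsHypothesis.ValiantsHypothesis.Theorems.GeneratorObstructionsGenInheritanceUpper

/-!
# Route GeneratorObstructions — typed split of the deciding crux `GenFlipThesis`, FRAME FORM (for `--glue-by`)

Same theorem as `GeneratorObstructionsGenFlipThesisSplit.lean` (`PerGenDegreeSuperQP → PowGenDegreeQP →
GenFlipThesis`, degree overflow through inheritance), but this module does NOT import the route module
`Summits.ValiantsHypothesis.ValiantsHypothesis.Theses.GeneratorObstructions`: the three statements are the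
route file's bodies INLINED VERBATIM (rev 2), so that the gate can import this module into the route file and
render `theorem GenFlipThesisGlueBy_holds : PerGenDegreeSuperQP → PowGenDegreeQP → GenFlipThesis :=
_root_.Summit.ValiantsHypothesis.ValiantsHypothesis.Theorems.GeneratorObstructionsFrame.genFlipThesis_of_subs_frame`
(typechecks by `δ`-unfolding the three route defs; simulated in the planner folder, `bc/SplitRenderSim.lean`, rc 0).
The inheritance step is the landed route-free helper theorem
`GenInheritance.exists_size_eq_and_finrank_ne_zero_rename` (`GeneratorObstructionsGenInheritanceUpper.lean`).
Crux-strategist BC2 redirect, 2026-08-17; to be landed by a prover as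
`Summits/ValiantsHypothesis/ValiantsHypothesis/Theorems/GeneratorObstructionsGenFlipThesisSplitFrame.lean --supports stmt-ValiantsHypothesis-11653`.
-/

namespace Summit.ValiantsHypothesis.ValiantsHypothesis.Theorems.GeneratorObstructionsFrame

open MvPolynomial
open Literature.NumberTheory.DiophantineGeometry Literature.Computability.AlgebraicComplexity

-- `Summit.ValiantsHypothesis.ValiantsHypothesis.…` is the tree's mandated single-conjunct layout (Sub = Summit).
set_option linter.dupNamespace false

/-- **Frame form of the split glue**: hypotheses = the bodies of `PerGenDegreeSuperQP` (K1) and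
`PowGenDegreeQP` (K2) verbatim, conclusion = the body of `GenFlipThesis` verbatim (route file rev 2).
Proof: K2 at `c` gives `c₀`; K1 at `c₀` beyond `max m₀ 1` gives `(m, χ)`; inheritance
(`GenInheritance.exists_size_eq_and_finrank_ne_zero_rename` for the block placement) gives `χ'` of the same
size with `γ_χ'(per_m) ≠ 0`; a trace-side generator of type `χ'` would violate the degree bounds. [folklore] -/
theorem genFlipThesis_of_subs_frame
    (hK1 : ∀ c m₀ : ℕ, ∃ m : ℕ, m₀ ≤ m ∧ ∃ χ : Literature.NumberTheory.DiophantineGeometry.Weight (Literature.NumberTheory.DiophantineGeometry.MatIdx m), Module.finrank ℂ (↥(Literature.NumberTheory.DiophantineGeometry.highestWeightSpace (Literature.Computability.AlgebraicComplexity.orbitCoordRep (MvPolynomial.rename toLex (Literature.Computability.AlgebraicComplexity.perPoly (Fin m) ℂ)) m) χ) ⧸ Submodule.comap (Literature.NumberTheory.DiophantineGeometry.highestWeightSpace (Literature.Computability.AlgebraicComplexity.orbitCoordRep (MvPolynomial.rename toLex (Literature.Computability.AlgebraicComplexity.perPoly (Fin m) ℂ)) m) χ).subtype (⨆ p : Literature.NumberTheory.DiophantineGeometry.Weight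 (Literature.NumberTheory.DiophantineGeometry.MatIdx m) × Literature.NumberTheory.DiophantineGeometry.Weight (Literature.NumberTheory.DiophantineGeometry.MatIdx m), ⨆ (_ : p.1 + p.2 = χ ∧ p.1 ≠ 0 ∧ p.2 ≠ 0), Literature.NumberTheory.DiophantineGeometry.highestWeightSpace (Literature.Computability.AlgebraicComplexity.orbitCoordRep (MvPolynomial.rename toLex (Literature.Computability.AlgebraicComplexity.perPoly (Fin m) ℂ)) m) p.1 * Literature.NumberTheory.DiophantineGeometry.highestWeightSpace (Literature.Computability.AlgebraicComplexity.orbitCoordRep (MvPolynomial.rename toLex (Literature.Computability.AlgebraicComplexity.perPoly (Fin m) ℂ)) m) p.2)) ≠ 0 ∧ (m : ℤ) * 2 ^ ((Nat.log 2 m + c) ^ c) < -(Literature.NumberTheory.DiophantineGeometry.Weight.size χ))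
    (hK2 : ∀ c : ℕ, ∃ c₀ : ℕ, ∀ m e : ℕ, 1 ≤ m → m + e ≤ 2 ^ ((Nat.log 2 m + c) ^ c) → ∀ χ : Literature.NumberTheory.DiophantineGeometry.Weight (Literature.NumberTheory.DiophantineGeometry.MatIdx (m + e)), Module.finrank ℂ (↥(Literature.NumberTheory.DiophantineGeometry.highestWeightSpace (Literature.Computability.AlgebraicComplexity.orbitCoordRep (Literature.NumberTheory.DiophantineGeometry.powFormLex ℂ (m + e) m) m) χ) ⧸ Submodule.comap (Literature.NumberTheory.DiophantineGeometry.highestWeightSpace (Literature.Computability.AlgebraicComplexity.orbitCoordRep (Literature.NumberTheory.DiophantineGeometry.powFormLex ℂ (m + e) m) m) χ).subtype (⨆ p : Literature.NumberTheory.DiophantineGeometry.Weight (Literature.NumberTheory.DiophantineGeometry.MatIdx (m + e)) × Literature.NumberTheory.DiophantineGeometry.Weight (Literature.NumberTheory.DiophantineGeometry.MatIdx (m + e)), ⨆ (_ : p.1 + p.2 = χ ∧ p.1 ≠ 0 ∧ p.2 ≠ 0), Literature.NumberTheory.DiophantineGeometry.highestWeightSpace (Literature.Computability.AlgebraicComplexity.orbitCoordRep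 (Literature.NumberTheory.DiophantineGeometry.powFormLex ℂ (m + e) m) m) p.1 * Literature.NumberTheory.DiophantineGeometry.highestWeightSpace (Literature.Computability.AlgebraicComplexity.orbitCoordRep (Literature.NumberTheory.DiophantineGeometry.powFormLex ℂ (m + e) m) m) p.2)) ≠ 0 → -(Literature.NumberTheory.DiophantineGeometry.Weight.size χ) ≤ (m : ℤ) * 2 ^ ((Nat.log 2 m + c₀) ^ c₀)) :
    ∀ c m₀ : ℕ, ∃ m : ℕ, m₀ ≤ m ∧ 1 ≤ m ∧ ∀ e : ℕ, m + e ≤ 2 ^ ((Nat.log 2 m + c) ^ c) → ∃ χ : Literature.NumberTheory.DiophantineGeometry.Weight (Literature.NumberTheory.DiophantineGeometry.MatIdx (m + e)), Module.finrank ℂ (↥(Literature.NumberTheory.DiophantineGeometry.highestWeightSpace (Literature.Computability.AlgebraicComplexity.orbitCoordRep (Literature.NumberTheory.DiophantineGeometry.powFormLex ℂ (m + e) m) m) χ) ⧸ Submodule.comap (Literature.NumberTheory.DiophantineGeometry.highestWeightSpace (Literature.Computability.AlgebraicComplexity.orbitCoordRep (Literature.NumberTheory.DiophantineGeometry.powFormLex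 ℂ (m + e) m) m) χ).subtype (⨆ p : Literature.NumberTheory.DiophantineGeometry.Weight (Literature.NumberTheory.DiophantineGeometry.MatIdx (m + e)) × Literature.NumberTheory.DiophantineGeometry.Weight (Literature.NumberTheory.DiophantineGeometry.MatIdx (m + e)), ⨆ (_ : p.1 + p.2 = χ ∧ p.1 ≠ 0 ∧ p.2 ≠ 0), Literature.NumberTheory.DiophantineGeometry.highestWeightSpace (Literature.Computability.AlgebraicComplexity.orbitCoordRep (Literature.NumberTheory.DiophantineGeometry.powFormLex ℂ (m + e) m) m) p.1 * Literature.NumberTheory.DiophantineGeometry.highestWeightSpace (Literature.Computability.AlgebraicComplexity.orbitCoordRep (Literature.NumberTheory.DiophantineGeometry.powFormLex ℂ (m + e) m) m) p.2)) < Module.finrank ℂ (↥(Literature.NumberTheory.DiophantineGeometry.highestWeightSpace (Literature.Computability.AlgebraicComplexity.orbitCoordRep (MvPolynomial.rename (fun ij : Fin m × Fin m => toLex (Fin.castAdd e ij.1, Fin.castAdd e ij.2)) (Literature.Computability.AlgebraicComplexity.perPoly (Fin m) ℂ)) m) χ) ⧸ Submodule.comap (Literature.NumberTheory.DiophantineGeometry.highestWeightSpace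 (Literature.Computability.AlgebraicComplexity.orbitCoordRep (MvPolynomial.rename (fun ij : Fin m × Fin m => toLex (Fin.castAdd e ij.1, Fin.castAdd e ij.2)) (Literature.Computability.AlgebraicComplexity.perPoly (Fin m) ℂ)) m) χ).subtype (⨆ p : Literature.NumberTheory.DiophantineGeometry.Weight (Literature.NumberTheory.DiophantineGeometry.MatIdx (m + e)) × Literature.NumberTheory.DiophantineGeometry.Weight (Literature.NumberTheory.DiophantineGeometry.MatIdx (m + e)), ⨆ (_ : p.1 + p.2 = χ ∧ p.1 ≠ 0 ∧ p.2 ≠ 0), Literature.NumberTheory.DiophantineGeometry.highestWeightSpace (Literature.Computability.AlgebraicComplexity.orbitCoordRep (MvPolynomial.rename (fun ij : Fin m × Fin m => toLex (Fin.castAdd e ij.1, Fin.castAdd e ij.2)) (Literature.Computability.AlgebraicComplexity.perPoly (Fin m) ℂ)) m) p.1 * Literature.NumberTheory.DiophantineGeometry.highestWeightSpace (Literature.Computability.AlgebraicComplexity.orbitCoordRep (MvPolynomial.rename (fun ij : Fin m × Fin m => toLex (Fin.castAdd e ij.1, Fin.castAdd e ij.2)) (Literature.Computability.AlgebraicComplexity.perPoly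 (Fin m) ℂ)) m) p.2)) := by
  intro c m₀
  obtain ⟨c₀, hc₀⟩ := hK2 c
  obtain ⟨m, hm, χ, hγ, hdeg⟩ := hK1 c₀ (max m₀ 1)
  have hm₀ : m₀ ≤ m := le_trans (le_max_left _ _) hm
  have h1m : 1 ≤ m := le_trans (le_max_right _ _) hm
  have hm0 : m ≠ 0 := by omega
  refine ⟨m, hm₀, h1m, fun e he => ?_⟩
  -- inheritance along the block placement (route-free helper theorem)
  have hf : (rename toLex (perPoly (Fin m) ℂ) : MvPolynomial (MatIdx m) ℂ).IsHomogeneous m := by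
    simpa using (perPoly_isHomogeneous (n := Fin m) (k := ℂ)).rename_isHomogeneous
      (f := (toLex : Fin m × Fin m → MatIdx m))
  have hf0 : (rename toLex (perPoly (Fin m) ℂ) : MvPolynomial (MatIdx m) ℂ) ≠ 0 :=
    (map_ne_zero_iff _ (rename_injective _ toLex.injective)).mpr (perPoly_ne_zero (Fin m) ℂ)
  have hκ : Function.Injective fun x : MatIdx m =>
      (toLex (Fin.castAdd e (ofLex x).1, Fin.castAdd e (ofLex x).2) : MatIdx (m + e)) := by
    intro x y hxy
    have h1 := toLex.injective hxy
    rw [Prod.mk.injEq] at h1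
    exact ofLex.injective (Prod.ext (Fin.castAdd_injective _ _ h1.1) (Fin.castAdd_injective _ _ h1.2))
  have key := GenInheritance.exists_size_eq_and_finrank_ne_zero_rename _ hκ hf hf0 hm0 χ hγ
  rw [rename_rename] at key
  obtain ⟨χ', hsize, hγ'⟩ := key
  refine ⟨χ', lt_of_not_ge fun hle => ?_⟩
  have hne := (Nat.lt_of_lt_of_le (Nat.pos_of_ne_zero hγ') hle).ne'
  have hb := hc₀ m e h1m he χ' hne
  rw [hsize] at hb
  exact absurd (lt_of_lt_of_le hdeg hb) (lt_irrefl _)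

end Summit.ValiantsHypothesis.ValiantsHypothesis.Theorems.GeneratorObstructionsFrame
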